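import Mathlib
import HarnessLib
import Summits.QuantumAdvantage.QuantumAdvantage.Theses.DyadicGap
import Literature.Computability.Complexity.Classes
import Literature.Computability.Complexity.ProbabilisticClassesProofs
import Literature.Computability.Complexity.CircuitLowerBoundsIW

/-!
# Route DyadicGap — glue of the typed split of the deciding crux `Target` (stmt-QuantumAdvantage-1840)

Strategist decomposition (BC2 redirect of a RESTATED deciding crux, human ruling 2026-08-16 21:1x) of
`Target` ≡ "some poly-time uniform oracle-free Toffoli+H family with polynomially QUANTIZED diagonal amplitudes has its
sign language outside `BPP`" along the DERANDOMIZATION SEAM — the one seam of `Target` that is a THEOREM of the tree rather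
than a tautology:

* X₁ `QSignNotInP` (crux): the same witness statement against DETERMINISTIC polynomial time — verbatim `Target` with
  `∉ BPP` replaced by `∉ Classes.P` ("quantized Toffoli+H signs beat P"); a CONSEQUENCE of `Target` (`qSignNotInP_of_target`,
  by the tree theorem `P_subset_BPP_holds`), strictly weaker unless `BPP ⊆ P`;
* X₂ `EHard` (crux, hypothesis-type, programme-wide; the SAME statement as item `YbEHard` = stmt-QuantumAdvantage-17622 of route
  YangBaxterIslands, so the ledger attaches this route to that item): some language in `E = DTIME(2^{O(n)})` has circuit complexity
  `≥ 2^{εn}` at all large `n` — VERBATIM the antecedent of the tree's PROVED Impagliazzo–Wigderson theorem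
  `Literature.Computability.Complexity.impagliazzo_wigderson_holds : EHard → P = BPP` (IW97 Thm 2; CircuitLowerBoundsIW.lean).

Main result `target_of_subs : X₁ → X₂ → Target` (hypotheses verbatim, children order). The seam is the theorem
`impagliazzo_wigderson_holds` (remove it and X₁ ∧ X₂ ↛ Target: X₂ mentions neither `BPP` nor quantum circuits); it is not an
`exact ⟨h₁, h₂⟩` cut of the ∃/∧ structure of `Target`. Disclosures (proved below): `Target → X₁`; `X₂ → (Target ↔ X₁)`;
and the trivial-seam variant with `BPP ⊆ P` as the second piece (`target_of_qSignNotInP_of_bppSubsetP`), recorded for the census.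

References: Impagliazzo–Wigderson 1997, Thm 2 [ImpagliazzoWigderson1997]; Nisan–Wigderson 1994, Thm 3 [NisanWigderson1994];
Arora–Barak 2009, Thm 20.7 [AroraBarakCC2009]; de Beaudrap 2015 (EQP/LWPP placement of exact & quantized classes) [deBeaudrap2015].
-/

set_option linter.dupNamespace false

namespace Summit.QuantumAdvantage.QuantumAdvantage.Cruxes.Target.DyadicGapSplit

open Literature.Computability.Complexity
open Summit.QuantumAdvantage.QuantumAdvantage.Theses.DyadicGap

/-- X₁ (local copy; after the split it is the route decl `Theses.DyadicGap.QSignNotInP`). -/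
def QSignNotInP : Prop :=
  ∃ (F : Literature.Computability.Cryptography.QCircuitFamily Literature.Computability.Cryptography.toffoliH) (c : ℕ), F.IsOracleFree ∧ @Literature.Computability.Cryptography.QCircuitFamily.IsUniform Literature.Computability.Cryptography.toffoliH (inferInstanceAs (Encodable Literature.Computability.Cryptography.ToffoliHOp)) F ∧ (∀ x : List Bool, ∃ (q : ℕ) (k : ℤ), 2 ^ q ≤ (x.length + 2) ^ c ∧ ((F.circ x.length).mat (Literature.Computability.Cryptography.padInput x.get (F.ancillas x.length)) (Literature.Computability.Cryptography.padInput x.get (F.ancillas x.length))) = (k : ℂ) / (2 : ℂ) ^ q) ∧ ({x : List Bool | 0 < ((F.circ x.length).mat (Literature.Computability.Cryptography.padInput x.get (F.ancillas x.length)) (Literature.Computability.Cryptography.padInput x.get (F.ancillas x.length))).re} : Language Bool) ∉ Literature.Computability.Complexity.Classes.P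

/-- X₂ (local copy; the shared item `YbEHard` = stmt-QuantumAdvantage-17622; after the split the route decl `Theses.DyadicGap.EHard`). -/
def EHard : Prop :=
  ∃ L ∈ Literature.Computability.Complexity.E, ∃ ε : ℝ, 0 < ε ∧ ∀ᶠ n : ℕ in Filter.atTop, (2 : ℝ) ^ (ε * n) ≤ (L.circuitSize n : ℝ)

/-- **Glue of the strategist's split of `Target`** (derandomization cut): `QSignNotInP → EHard → Target`, hypotheses written
out VERBATIM and in the children order of `route edit --split Target`, so the generated glue item is closed by
`exact target_of_subs`. Proof: Impagliazzo–Wigderson (tree theorem `impagliazzo_wigderson_holds`) turns X₂ into `P = BPP`;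
the witness family of X₁ is then a witness of `Target`. [cite: ImpagliazzoWigderson1997, Thm 2] -/
theorem target_of_subs
    (h₁ : ∃ (F : Literature.Computability.Cryptography.QCircuitFamily Literature.Computability.Cryptography.toffoliH) (c : ℕ), F.IsOracleFree ∧ @Literature.Computability.Cryptography.QCircuitFamily.IsUniform Literature.Computability.Cryptography.toffoliH (inferInstanceAs (Encodable Literature.Computability.Cryptography.ToffoliHOp)) F ∧ (∀ x : List Bool, ∃ (q : ℕ) (k : ℤ), 2 ^ q ≤ (x.length + 2) ^ c ∧ ((F.circ x.length).mat (Literature.Computability.Cryptography.padInput x.get (F.ancillas x.length)) (Literature.Computability.Cryptography.padInput x.get (F.ancillas x.length))) = (k : ℂ) / (2 : ℂ) ^ q) ∧ ({x : List Bool | 0 < ((F.circ x.length).mat (Literature.Computability.Cryptography.padInput x.get (F.ancillas x.length)) (Literature.Computability.Cryptography.padInput x.get (F.ancillas x.length))).re} : Language Bool) ∉ Literature.Computability.Complexity.Classes.P)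
    (h₂ : ∃ L ∈ Literature.Computability.Complexity.E, ∃ ε : ℝ, 0 < ε ∧ ∀ᶠ n : ℕ in Filter.atTop, (2 : ℝ) ^ (ε * n) ≤ (L.circuitSize n : ℝ)) :
    Summit.QuantumAdvantage.QuantumAdvantage.Theses.DyadicGap.Target := by
  have hPB : Classes.P = BPP := impagliazzo_wigderson_holds h₂
  obtain ⟨F, c, hof, hu, hq, hnP⟩ := h₁
  refine ⟨F, c, hof, hu, hq, fun hB => hnP ?_⟩
  rw [hPB]
  exact hB

/-- The same, over the local names. -/
theorem target_of_subs' (h₁ : QSignNotInP) (h₂ : EHard) : Target :=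
  target_of_subs h₁ h₂

/-! ### Disclosures (what each piece is, relative to the crux) -/

/-- `Target → X₁`: piece 1 is NECESSARY (a `P` machine is a `BPP` machine, tree theorem `P_subset_BPP_holds`). -/
theorem qSignNotInP_of_target (h : Target) : QSignNotInP := by
  obtain ⟨F, c, hof, hu, hq, hnB⟩ := h
  exact ⟨F, c, hof, hu, hq, fun hP => hnB (P_subset_BPP_holds hP)⟩

/-- Under piece 2 the crux and piece 1 coincide: `EHard → (Target ↔ QSignNotInP)` — piece 2 is exactly what converts the
crux into piece 1 (`P = BPP` is open, so this is NOT an iff between an item and the crux). -/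
theorem target_iff_qSignNotInP_of_eHard (h₂ : EHard) : Target ↔ QSignNotInP :=
  ⟨qSignNotInP_of_target, fun h₁ => target_of_subs' h₁ h₂⟩

/-- What piece 2 buys, and ONLY that: `EHard → P = BPP` (the tree's Impagliazzo–Wigderson theorem, restated). -/
theorem P_eq_BPP_of_eHard (h₂ : EHard) : Classes.P = BPP :=
  impagliazzo_wigderson_holds h₂

/-- Census variant D2′ (TRIVIAL seam, not filed): with `BPP ⊆ P` itself as the second piece the assembly is modus ponens. -/
theorem target_of_qSignNotInP_of_bppSubsetP (h₁ : QSignNotInP) (h₂ : BPP ⊆ Classes.P) : Target := by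
  obtain ⟨F, c, hof, hu, hq, hnP⟩ := h₁
  exact ⟨F, c, hof, hu, hq, fun hB => hnP (h₂ hB)⟩

end Summit.QuantumAdvantage.QuantumAdvantage.Cruxes.Target.DyadicGapSplit
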